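import Literature.GroupTheory.SpecificGroups.OrthogonalThreeSymmetricNilpotentOrbitsRankOne   -- ★ p846931 (this seat): `J₀` tokens, `dotProduct_cornerSymmetric_form`, `dotProduct_mulVec_conj_of_mem`, `transpose_mul_mul_eq_of_mem_orthogonal`
import HarnessLib

/-!
# Isotropic points of the ternary conic `ᵗx J₀ x = 0` killed by the form `ᵗx (J₀Y) x` of a nilpotent `J₀`-symmetric `Y`: ONE point for `Y ~ N(c)`, TWO for `Y ~ R`
# (the finite half of the fixed-child count on the ramified `U₃` tree — A′ (ii) «shell recursion», F0P2-p01 (g15) FILE 1 §1)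

Topic `Literature/GroupTheory/SpecificGroups`; namespace `Literature.GroupTheory.SpecificGroups`.  THEOREMS ONLY (no definition, no named fact, no instance, no notation,
no `sorry`).  Cell `pub/hodgecm-mathlib` (crux H413 = `stmt-HodgeConjecture-24833`), «S3-ram» seeding wave (LEAD F0P3a-plan (g12); owner∕desk F0P3a-p06 (g15); architect
A-p16 (g31) row A′ (ii) «fixed-child COUNT ∕ shell recursion», hand F0P2-p01 (g15) 22:47:34Z, §1 FINITE dealt to this seat 22:5xZ).  SETTING: `K` a field, `J₀ = antidiag(1,1,1)`
(`ᵗxJ₀x = 2x₁x₃ + x₂²`), the nilpotent `J₀`-symmetric normal forms `N(c) = c·E₃₁` (rank 1, either square class) and `R = E₂₁ + E₃₂` (rank 2) of ★ p846931∕p846945, and for a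
`J₀`-symmetric `Y` the symmetric form `x ↦ ᵗx (J₀Y) x` (★ p846931's «common value» token).  On the ramified `U₃` tree a vertex fixed by `γ = 1 + ϖ Y` has as fixed outward
children the isotropic residual points `x̄` with `B̄₀(x̄, Ȳx̄) = ᵗx̄(J₀Ȳ)x̄ = 0` (★ p847060 `…FixedChild…`, F0P2-p01's criterion); THIS FILE counts them by the `O(J₀)`-type of `Ȳ`:
* (C1) `Y = N(c)`, `c ≠ 0`: `ᵗxJ₀x = 0 ∧ c·x₁² = 0 ⇔ x ∈ ⟨e₃⟩` (`= im N(c)`) — ONE point, class-independent;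
* (C2) `Y = R`, `2 ≠ 0`: `ᵗxJ₀x = 0 ∧ 2x₁x₂ = 0 ⇔ x ∈ ⟨e₃⟩ ∪ ⟨e₁⟩` (`ker R` and its hyperbolic partner) — TWO points;
* (C3) transport: for `g ∈ O(J₀)` both forms are `g`-covariant, so for ANY `Y` with `gYg⁻¹ = N(c)` (resp. `= R`) the solution set is `g⁻¹⟨e₃⟩` (resp. `g⁻¹(⟨e₃⟩ ∪ ⟨e₁⟩)`);
* (C4) over a finite field (`q = |K|`): the non-zero solution VECTORS number `q − 1` (resp. `2(q − 1)`), i.e. one (resp. two) points, and the conic itself has `q² − 1` non-zero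
  vectors (`q + 1` points) when `2 ≠ 0`.
HONEST LABEL: HC_CM is proved only modulo the printed citations (the 2 remaining named inputs hLiu418 24832, h413 24833) until rung 0 closes; elementary algebra, count-neutral
Literature seeding; nothing printed about the transfer is asserted.

## References
* [Wilson2009] R. A. Wilson, *The Finite Simple Groups*, GTM 251 (2009): §3.7.1 p. 70 (isotropic vectors of a ternary quadratic form; `q + 1` points on a conic), §3.7.2 p. 71.
* [CollingwoodMcGovern1993] D. Collingwood, W. McGovern, *Nilpotent Orbits in Semisimple Lie Algebras* (1993): §9.3 (normal forms `N(c)`, `R`).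
* [BruhatTits1972] F. Bruhat, J. Tits, *Groupes réductifs sur un corps local* I, Publ. Math. IHÉS 41 (1972): §10 (the residual building at a vertex).
-/

set_option autoImplicit false

open Matrix Literature.NumberTheory.Automorphic Literature.NumberTheory.Automorphic.HermitianLattice Literature.NumberTheory.Automorphic.UnitaryGroup

namespace Literature.GroupTheory.SpecificGroups

variable {K : Type*} [Field K]

/-! ## §1 The three quadratic forms at the normal forms -/

section Forms

/-- `ᵗx J₀ x = x₁x₃ + x₂² + x₃x₁`. [cite: Wilson2009, §3.7.1 p. 70] -/
theorem dotProduct_antidiagonal_three_mulVec (x : Fin 3 → K) :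
    x ⬝ᵥ (((StdForm.antidiagonal 3).over K) *ᵥ x) = x 0 * x 2 + x 1 * x 1 + x 2 * x 0 := by
  rw [antidiagonal_three_over_eq]
  simp [Matrix.mulVec, dotProduct, Fin.sum_univ_three]

/-- `ᵗx (J₀R) x = 2·x₁x₂` for the regular nilpotent `R = E₂₁ + E₃₂`. [cite: CollingwoodMcGovern1993, §9.3] -/
theorem dotProduct_regularSymmetric_form (x : Fin 3 → K) :
    x ⬝ᵥ (((StdForm.antidiagonal 3).over K * !![0, 0, 0; 1, 0, 0; 0, 1, 0]) *ᵥ x) = 2 * (x 0 * x 1) := by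
  rw [antidiagonal_three_over_eq]
  have h : (!![(0 : K), 0, 1; 0, 1, 0; 1, 0, 0] : Matrix (Fin 3) (Fin 3) K) * !![0, 0, 0; 1, 0, 0; 0, 1, 0] = !![0, 1, 0; 1, 0, 0; 0, 0, 0] := by
    ext i j; fin_cases i <;> fin_cases j <;> simp [Matrix.mul_apply, Fin.sum_univ_three]
  rw [h]
  simp [Matrix.mulVec, dotProduct, Fin.sum_univ_three]
  ring

end Forms

/-! ## §2 (C1)(C2): the killed isotropic points at the normal forms -/

section NormalForms

/-- **(C1) rank one**: for `c ≠ 0`, `ᵗxJ₀x = 0 ∧ ᵗx(J₀N(c))x = 0 ⇔ x₁ = x₂ = 0` — the single point `⟨e₃⟩ = im N(c)`, whatever the square class of `c`.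
[cite: Wilson2009, §3.7.1 p. 70] [cite: CollingwoodMcGovern1993, §9.3] -/
theorem isotropic_and_cornerSymmetric_form_eq_zero_iff {c : K} (hc : c ≠ 0) (x : Fin 3 → K) :
    (x ⬝ᵥ (((StdForm.antidiagonal 3).over K) *ᵥ x) = 0 ∧ x ⬝ᵥ (((StdForm.antidiagonal 3).over K * !![0, 0, 0; 0, 0, 0; c, 0, 0]) *ᵥ x) = 0) ↔
      (x 0 = 0 ∧ x 1 = 0) := by
  rw [dotProduct_antidiagonal_three_mulVec, dotProduct_cornerSymmetric_form]
  constructor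
  · rintro ⟨hiso, hN⟩
    have h0 : x 0 = 0 := by
      rcases mul_eq_zero.1 hN with h | h
      · exact absurd h hc
      · exact (sq_eq_zero_iff.1 h)
    rw [h0, zero_mul, mul_zero, zero_add, add_zero] at hiso
    exact ⟨h0, mul_self_eq_zero.1 hiso⟩
  · rintro ⟨h0, h1⟩
    rw [h0, h1]; constructor <;> ring

/-- **(C2) rank two**: for `2 ≠ 0`, `ᵗxJ₀x = 0 ∧ ᵗx(J₀R)x = 0 ⇔ (x₁ = x₂ = 0) ∨ (x₂ = x₃ = 0)` — the two points `⟨e₃⟩ = ker R` and `⟨e₁⟩`.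
[cite: Wilson2009, §3.7.1 p. 70] [cite: CollingwoodMcGovern1993, §9.3] -/
theorem isotropic_and_regularSymmetric_form_eq_zero_iff (h2 : (2 : K) ≠ 0) (x : Fin 3 → K) :
    (x ⬝ᵥ (((StdForm.antidiagonal 3).over K) *ᵥ x) = 0 ∧ x ⬝ᵥ (((StdForm.antidiagonal 3).over K * !![0, 0, 0; 1, 0, 0; 0, 1, 0]) *ᵥ x) = 0) ↔
      (x 0 = 0 ∧ x 1 = 0) ∨ (x 1 = 0 ∧ x 2 = 0) := by
  rw [dotProduct_antidiagonal_three_mulVec, dotProduct_regularSymmetric_form]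
  constructor
  · rintro ⟨hiso, hR⟩
    rcases mul_eq_zero.1 hR with h | h
    · exact absurd h h2
    rcases mul_eq_zero.1 h with h0 | h1
    · rw [h0, zero_mul, mul_zero, zero_add, add_zero] at hiso
      exact Or.inl ⟨h0, mul_self_eq_zero.1 hiso⟩
    · rw [h1, mul_zero, add_zero] at hiso
      -- `hiso : x 0 * x 2 + x 2 * x 0 = 0`
      have h02 : x 0 * x 2 = 0 := by
        have : (2 : K) * (x 0 * x 2) = 0 := by linear_combination hiso
        exact (mul_eq_zero.1 this).resolve_left h2
      rcases mul_eq_zero.1 h02 with h0 | h2'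
      · exact Or.inl ⟨h0, h1⟩
      · exact Or.inr ⟨h1, h2'⟩
  · rintro (⟨h0, h1⟩ | ⟨h1, h2'⟩)
    · rw [h0, h1]; constructor <;> ring
    · rw [h1, h2']; constructor <;> ring

end NormalForms

/-! ## §3 (C3): transport by `O(J₀)` — both forms are covariant -/

section Transport

/-- Isotropy is `O(J₀)`-invariant: `ᵗ(gx) J₀ (gx) = ᵗx J₀ x`. [cite: Wilson2009, §3.7.1 p. 70] -/
theorem dotProduct_antidiagonal_mulVec_of_mem {g : GL (Fin 3) K} (hg : g ∈ unitaryGroupOfForm (RingHom.id K) ((StdForm.antidiagonal 3).over K)) (x : Fin 3 → K) :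
    ((g : Matrix (Fin 3) (Fin 3) K) *ᵥ x) ⬝ᵥ (((StdForm.antidiagonal 3).over K) *ᵥ ((g : Matrix (Fin 3) (Fin 3) K) *ᵥ x)) = x ⬝ᵥ (((StdForm.antidiagonal 3).over K) *ᵥ x) := by
  have h := transpose_mul_mul_eq_of_mem_orthogonal hg
  conv_rhs => rw [← h, ← Matrix.mulVec_mulVec, ← Matrix.mulVec_mulVec, Matrix.dotProduct_mulVec, Matrix.vecMul_transpose]

/-- The killing form is `O(J₀)`-covariant: `ᵗx J₀ (gYg⁻¹) x = ᵗ(g⁻¹x) J₀ Y (g⁻¹x)`. [cite: Wilson2009, §3.7.1 p. 70] -/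
theorem dotProduct_form_conj_of_mem {g : GL (Fin 3) K} (hg : g ∈ unitaryGroupOfForm (RingHom.id K) ((StdForm.antidiagonal 3).over K))
    (Y : Matrix (Fin 3) (Fin 3) K) (x : Fin 3 → K) :
    x ⬝ᵥ (((StdForm.antidiagonal 3).over K * ((g : Matrix (Fin 3) (Fin 3) K) * Y * ((g⁻¹ : GL (Fin 3) K) : Matrix (Fin 3) (Fin 3) K))) *ᵥ x) =
      (((g⁻¹ : GL (Fin 3) K) : Matrix (Fin 3) (Fin 3) K) *ᵥ x) ⬝ᵥ (((StdForm.antidiagonal 3).over K * Y) *ᵥ (((g⁻¹ : GL (Fin 3) K) : Matrix (Fin 3) (Fin 3) K) *ᵥ x)) := by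
  have h := dotProduct_mulVec_conj_of_mem (inv_mem hg) Y x
  rw [inv_inv] at h
  exact h

/-- **(C1) in the orbit**: if `g ∈ O(J₀)` and `gYg⁻¹ = N(c)`, `c ≠ 0`, the isotropic points killed by `ᵗx(J₀Y)x` are exactly `g⁻¹⟨e₃⟩`, read as `(gx)₁ = (gx)₂ = 0`.
[cite: Wilson2009, §3.7.1 p. 70] [cite: CollingwoodMcGovern1993, §9.3] -/
theorem isotropic_and_form_eq_zero_iff_of_conj_cornerSymmetric {g : GL (Fin 3) K} (hg : g ∈ unitaryGroupOfForm (RingHom.id K) ((StdForm.antidiagonal 3).over K))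
    {c : K} (hc : c ≠ 0) {Y : Matrix (Fin 3) (Fin 3) K}
    (hY : (g : Matrix (Fin 3) (Fin 3) K) * Y * ((g⁻¹ : GL (Fin 3) K) : Matrix (Fin 3) (Fin 3) K) = !![0, 0, 0; 0, 0, 0; c, 0, 0]) (x : Fin 3 → K) :
    (x ⬝ᵥ (((StdForm.antidiagonal 3).over K) *ᵥ x) = 0 ∧ x ⬝ᵥ (((StdForm.antidiagonal 3).over K * Y) *ᵥ x) = 0) ↔
      (((g : Matrix (Fin 3) (Fin 3) K) *ᵥ x) 0 = 0 ∧ ((g : Matrix (Fin 3) (Fin 3) K) *ᵥ x) 1 = 0) := by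
  have hYe : Y = ((g⁻¹ : GL (Fin 3) K) : Matrix (Fin 3) (Fin 3) K) * !![0, 0, 0; 0, 0, 0; c, 0, 0] * (g : Matrix (Fin 3) (Fin 3) K) := by
    rw [← hY, coe_inv_mul_conj_mul_coe]
  rw [← isotropic_and_cornerSymmetric_form_eq_zero_iff hc, ← dotProduct_antidiagonal_mulVec_of_mem hg x, hYe, dotProduct_mulVec_conj_of_mem hg]

/-- **(C2) in the orbit**: if `g ∈ O(J₀)` and `gYg⁻¹ = R`, `2 ≠ 0`, the isotropic points killed by `ᵗx(J₀Y)x` are exactly `g⁻¹⟨e₃⟩ ∪ g⁻¹⟨e₁⟩`.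
[cite: Wilson2009, §3.7.1 p. 70] [cite: CollingwoodMcGovern1993, §9.3] -/
theorem isotropic_and_form_eq_zero_iff_of_conj_regularSymmetric (h2 : (2 : K) ≠ 0) {g : GL (Fin 3) K}
    (hg : g ∈ unitaryGroupOfForm (RingHom.id K) ((StdForm.antidiagonal 3).over K)) {Y : Matrix (Fin 3) (Fin 3) K}
    (hY : (g : Matrix (Fin 3) (Fin 3) K) * Y * ((g⁻¹ : GL (Fin 3) K) : Matrix (Fin 3) (Fin 3) K) = !![0, 0, 0; 1, 0, 0; 0, 1, 0]) (x : Fin 3 → K) :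
    (x ⬝ᵥ (((StdForm.antidiagonal 3).over K) *ᵥ x) = 0 ∧ x ⬝ᵥ (((StdForm.antidiagonal 3).over K * Y) *ᵥ x) = 0) ↔
      ((((g : Matrix (Fin 3) (Fin 3) K) *ᵥ x) 0 = 0 ∧ ((g : Matrix (Fin 3) (Fin 3) K) *ᵥ x) 1 = 0) ∨
        (((g : Matrix (Fin 3) (Fin 3) K) *ᵥ x) 1 = 0 ∧ ((g : Matrix (Fin 3) (Fin 3) K) *ᵥ x) 2 = 0)) := by
  have hYe : Y = ((g⁻¹ : GL (Fin 3) K) : Matrix (Fin 3) (Fin 3) K) * !![0, 0, 0; 1, 0, 0; 0, 1, 0] * (g : Matrix (Fin 3) (Fin 3) K) := by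
    rw [← hY, coe_inv_mul_conj_mul_coe]
  rw [← isotropic_and_regularSymmetric_form_eq_zero_iff h2, ← dotProduct_antidiagonal_mulVec_of_mem hg x, hYe, dotProduct_mulVec_conj_of_mem hg]

end Transport

/-! ## §4 (C4): the counts over a finite field (non-zero solution vectors; divide by `q − 1` for points) -/

section Counts

variable [Fintype K]

/-- The line `⟨e₃⟩` minus the origin has `q − 1` vectors. [cite: Wilson2009, §3.7.1 p. 70] -/
theorem ncard_setOf_ne_zero_and_apply_zero_and_apply_one :
    {x : Fin 3 → K | x ≠ 0 ∧ x 0 = 0 ∧ x 1 = 0}.ncard = Fintype.card K - 1 := by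
  have hset : {x : Fin 3 → K | x ≠ 0 ∧ x 0 = 0 ∧ x 1 = 0} = (fun t : K => (Pi.single 2 t : Fin 3 → K)) '' {t : K | t ≠ 0} := by
    ext x
    simp only [Set.mem_setOf_eq, Set.mem_image]
    constructor
    · rintro ⟨hx, h0, h1⟩
      refine ⟨x 2, fun h => hx ?_, ?_⟩
      · ext i; fin_cases i <;> simp [h0, h1, h]
      · ext i; fin_cases i <;> simp [h0, h1]
    · rintro ⟨t, ht, rfl⟩
      exact ⟨fun h => ht (by simpa using congrFun h 2), by simp, by simp⟩
  have hinj : Function.Injective (fun t : K => (Pi.single 2 t : Fin 3 → K)) := fun a b h => by simpa using congrFun h 2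
  rw [hset, Set.ncard_image_of_injective _ hinj]
  have : {t : K | t ≠ 0} = Set.univ \ {0} := by ext t; simp
  rw [this, Set.ncard_sdiff_singleton_of_mem (Set.mem_univ _), Set.ncard_univ, Nat.card_eq_fintype_card]

/-- The line `⟨e₁⟩` minus the origin has `q − 1` vectors. [cite: Wilson2009, §3.7.1 p. 70] -/
theorem ncard_setOf_ne_zero_and_apply_one_and_apply_two :
    {x : Fin 3 → K | x ≠ 0 ∧ x 1 = 0 ∧ x 2 = 0}.ncard = Fintype.card K - 1 := by
  have hset : {x : Fin 3 → K | x ≠ 0 ∧ x 1 = 0 ∧ x 2 = 0} = (fun t : K => (Pi.single 0 t : Fin 3 → K)) '' {t : K | t ≠ 0} := by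
    ext x
    simp only [Set.mem_setOf_eq, Set.mem_image]
    constructor
    · rintro ⟨hx, h1, h2⟩
      refine ⟨x 0, fun h => hx ?_, ?_⟩
      · ext i; fin_cases i <;> simp [h1, h2, h]
      · ext i; fin_cases i <;> simp [h1, h2]
    · rintro ⟨t, ht, rfl⟩
      exact ⟨fun h => ht (by simpa using congrFun h 0), by simp, by simp⟩
  have hinj : Function.Injective (fun t : K => (Pi.single 0 t : Fin 3 → K)) := fun a b h => by simpa using congrFun h 0
  rw [hset, Set.ncard_image_of_injective _ hinj]
  have : {t : K | t ≠ 0} = Set.univ \ {0} := by ext t; simp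
  rw [this, Set.ncard_sdiff_singleton_of_mem (Set.mem_univ _), Set.ncard_univ, Nat.card_eq_fintype_card]

/-- **(C4, rank one) ONE POINT**: the non-zero isotropic vectors killed by `ᵗx(J₀N(c))x`, `c ≠ 0`, number `q − 1`. [cite: Wilson2009, §3.7.1 p. 70] -/
theorem ncard_isotropic_cornerSymmetric_form_eq_zero {c : K} (hc : c ≠ 0) :
    {x : Fin 3 → K | x ≠ 0 ∧ x ⬝ᵥ (((StdForm.antidiagonal 3).over K) *ᵥ x) = 0 ∧
      x ⬝ᵥ (((StdForm.antidiagonal 3).over K * !![0, 0, 0; 0, 0, 0; c, 0, 0]) *ᵥ x) = 0}.ncard = Fintype.card K - 1 := by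
  have hset : {x : Fin 3 → K | x ≠ 0 ∧ x ⬝ᵥ (((StdForm.antidiagonal 3).over K) *ᵥ x) = 0 ∧
      x ⬝ᵥ (((StdForm.antidiagonal 3).over K * !![0, 0, 0; 0, 0, 0; c, 0, 0]) *ᵥ x) = 0} = {x : Fin 3 → K | x ≠ 0 ∧ x 0 = 0 ∧ x 1 = 0} := by
    ext x
    simp only [Set.mem_setOf_eq]
    rw [isotropic_and_cornerSymmetric_form_eq_zero_iff hc]
  rw [hset, ncard_setOf_ne_zero_and_apply_zero_and_apply_one]

/-- **(C4, rank two) TWO POINTS**: the non-zero isotropic vectors killed by `ᵗx(J₀R)x` number `2(q − 1)` (`2 ≠ 0`). [cite: Wilson2009, §3.7.1 p. 70] -/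
theorem ncard_isotropic_regularSymmetric_form_eq_zero (h2 : (2 : K) ≠ 0) :
    {x : Fin 3 → K | x ≠ 0 ∧ x ⬝ᵥ (((StdForm.antidiagonal 3).over K) *ᵥ x) = 0 ∧
      x ⬝ᵥ (((StdForm.antidiagonal 3).over K * !![0, 0, 0; 1, 0, 0; 0, 1, 0]) *ᵥ x) = 0}.ncard = 2 * (Fintype.card K - 1) := by
  have hset : {x : Fin 3 → K | x ≠ 0 ∧ x ⬝ᵥ (((StdForm.antidiagonal 3).over K) *ᵥ x) = 0 ∧
      x ⬝ᵥ (((StdForm.antidiagonal 3).over K * !![0, 0, 0; 1, 0, 0; 0, 1, 0]) *ᵥ x) = 0} =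
      {x : Fin 3 → K | x ≠ 0 ∧ x 0 = 0 ∧ x 1 = 0} ∪ {x : Fin 3 → K | x ≠ 0 ∧ x 1 = 0 ∧ x 2 = 0} := by
    ext x
    simp only [Set.mem_setOf_eq, Set.mem_union]
    rw [isotropic_and_regularSymmetric_form_eq_zero_iff h2]
    tauto
  have hdisj : Disjoint {x : Fin 3 → K | x ≠ 0 ∧ x 0 = 0 ∧ x 1 = 0} {x : Fin 3 → K | x ≠ 0 ∧ x 1 = 0 ∧ x 2 = 0} := by
    rw [Set.disjoint_left]
    rintro x ⟨hx, h0, h1⟩ ⟨-, -, h2'⟩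
    exact hx (by ext i; fin_cases i <;> simp [h0, h1, h2'])
  rw [hset, Set.ncard_union_eq hdisj, ncard_setOf_ne_zero_and_apply_zero_and_apply_one, ncard_setOf_ne_zero_and_apply_one_and_apply_two]
  ring

/-- **The conic has `q² − 1` non-zero vectors** (`q + 1` points): `2x₁x₃ + x₂² = 0`, `2 ≠ 0` — `x₃ ≠ 0` gives `x₁ = −x₂²∕(2x₃)` (`q(q − 1)` vectors), `x₃ = 0` forces `x₂ = 0`
(`q − 1` vectors). [cite: Wilson2009, §3.7.1 p. 70] -/
theorem ncard_isotropic_ne_zero (h2 : (2 : K) ≠ 0) :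
    {x : Fin 3 → K | x ≠ 0 ∧ x ⬝ᵥ (((StdForm.antidiagonal 3).over K) *ᵥ x) = 0}.ncard = Fintype.card K ^ 2 - 1 := by
  -- split by `x 2 = 0`
  have hsplit : {x : Fin 3 → K | x ≠ 0 ∧ x ⬝ᵥ (((StdForm.antidiagonal 3).over K) *ᵥ x) = 0} =
      {x : Fin 3 → K | x ≠ 0 ∧ x 1 = 0 ∧ x 2 = 0} ∪
        (fun p : K × K => (![-(p.1 * p.1) / (2 * p.2), p.1, p.2] : Fin 3 → K)) '' {p : K × K | p.2 ≠ 0} := by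
    ext x
    simp only [Set.mem_setOf_eq, Set.mem_union, Set.mem_image, dotProduct_antidiagonal_three_mulVec]
    constructor
    · rintro ⟨hx, hiso⟩
      by_cases hx2 : x 2 = 0
      · left
        rw [hx2, mul_zero, zero_mul, zero_add, add_zero] at hiso
        exact ⟨hx, mul_self_eq_zero.1 hiso, hx2⟩
      · right
        refine ⟨(x 1, x 2), hx2, ?_⟩
        have hx0 : x 0 = -(x 1 * x 1) / (2 * x 2) := by
          field_simp
          linear_combination hiso
        ext i; fin_cases i <;> simp [hx0]
    · rintro (⟨hx, h1, hx2⟩ | ⟨p, hp, rfl⟩)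
      · refine ⟨hx, ?_⟩
        rw [h1, hx2]; ring
      · refine ⟨fun h => hp (by simpa using congrFun h 2), ?_⟩
        simp
        field_simp
        ring
  have hdisj : Disjoint {x : Fin 3 → K | x ≠ 0 ∧ x 1 = 0 ∧ x 2 = 0}
      ((fun p : K × K => (![-(p.1 * p.1) / (2 * p.2), p.1, p.2] : Fin 3 → K)) '' {p : K × K | p.2 ≠ 0}) := by
    rw [Set.disjoint_left]
    rintro x ⟨-, -, hx2⟩ ⟨p, hp, rfl⟩
    exact hp (by simpa using hx2)
  have hinj : Function.Injective (fun p : K × K => (![-(p.1 * p.1) / (2 * p.2), p.1, p.2] : Fin 3 → K)) := by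
    rintro ⟨a, b⟩ ⟨a', b'⟩ h
    have h1 := congrFun h 1
    have h2' := congrFun h 2
    simp at h1 h2'
    rw [h1, h2']
  have hpairs : {p : K × K | p.2 ≠ 0}.ncard = Fintype.card K * (Fintype.card K - 1) := by
    have : {p : K × K | p.2 ≠ 0} = (Set.univ : Set K) ×ˢ ((Set.univ : Set K) \ {0}) := by
      ext p; simp
    rw [this, Set.ncard_prod, Set.ncard_univ, Nat.card_eq_fintype_card, Set.ncard_sdiff_singleton_of_mem (Set.mem_univ _), Set.ncard_univ,
      Nat.card_eq_fintype_card]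
  rw [hsplit, Set.ncard_union_eq hdisj, ncard_setOf_ne_zero_and_apply_one_and_apply_two, Set.ncard_image_of_injective _ hinj, hpairs]
  have hq : 1 ≤ Fintype.card K := Fintype.card_pos
  zify [hq, Nat.one_le_pow 2 _ hq]
  ring

end Counts

end Literature.GroupTheory.SpecificGroups
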